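import Mathlib.Combinatorics.Matroid.Minor.Contract
import Mathlib.Data.Set.Card

/-!
# PercRepro — the 4-circuits through `e` inject into the triangles of `M ／ {e}` (p1, gen 20; paper §18 (1))

`C ↦ C ∖ {e}` sends a 4-circuit through `e` to a 3-circuit of the contraction, injectively.
Axioms: standard.
-/

open scoped Matroid

namespace PercRepro

namespace S1

open Set

variable {α : Type}

/-- **#4circ(e) ≤ s₃(M ／ {e})**: the 4-circuits through `e` are at most the triangles of the contraction. -/
theorem ncard_fourCircuitsThrough_le_ncard_triangles_contract (M : Matroid α) [M.Finite] (e : α) :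
    {C : Set α | M.IsCircuit C ∧ C.ncard = 4 ∧ e ∈ C}.ncard ≤
      {C : Set α | (M ／ {e}).IsCircuit C ∧ C.ncard = 3}.ncard := by
  classical
  have htfin : {C : Set α | (M ／ {e}).IsCircuit C ∧ C.ncard = 3}.Finite :=
    (M ／ {e}).ground_finite.finite_subsets.subset (fun C hC => hC.1.subset_ground)
  refine ncard_le_ncard_of_injOn (fun C => C \ {e}) ?_ ?_ htfin
  · intro C hC
    obtain ⟨hC, h4, heC⟩ := hC
    have hCfin : C.Finite := M.ground_finite.subset hC.subset_ground
    have hnt : C.Nontrivial := (one_lt_ncard hCfin).1 (by omega)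
    refine ⟨hC.contractElem_isCircuit hnt heC, ?_⟩
    rw [ncard_sdiff_singleton_of_mem heC, h4]
  · intro C₁ hC₁ C₂ hC₂ h
    have h1 : insert e (C₁ \ {e}) = C₁ := by
      rw [insert_sdiff_singleton, insert_eq_of_mem hC₁.2.2]
    have h2 : insert e (C₂ \ {e}) = C₂ := by
      rw [insert_sdiff_singleton, insert_eq_of_mem hC₂.2.2]
    rw [← h1, ← h2]
    exact congrArg (insert e) h

/-- **The crossing property** (paper §18 (2)): under `hfree` at `e` with the partition `A ⊔ ((E ∖ e) ∖ A)`, a circuit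
through `e` is not contained in `A ∪ {e}`, nor in `(E ∖ A)`: its other points meet both sides. -/
theorem IsCircuit.not_subset_of_not_mem_closure {M : Matroid α} {C A : Set α} {e : α}
    (hC : M.IsCircuit C) (heC : e ∈ C) (hA : e ∉ M.closure A) : ¬ (C \ {e} ⊆ A) := by
  intro h
  exact hA (M.closure_subset_closure h (hC.mem_closure_sdiff_singleton_of_mem heC))

/-- A 4-circuit through `e` meets both sides of the `hfree` partition of `e`. -/
theorem fourCircuit_crosses (M : Matroid α) {C A : Set α} {e : α} (hC : M.IsCircuit C) (heC : e ∈ C)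
    (hA : e ∉ M.closure A) (hB : e ∉ M.closure ((M.E \ {e}) \ A)) :
    (C \ {e} ∩ A).Nonempty ∧ (C \ {e} ∩ ((M.E \ {e}) \ A)).Nonempty := by
  constructor
  · by_contra hne
    rw [not_nonempty_iff_eq_empty] at hne
    refine IsCircuit.not_subset_of_not_mem_closure hC heC hB (fun x hx => ?_)
    refine ⟨⟨hC.subset_ground hx.1, hx.2⟩, fun hxA => ?_⟩
    have : x ∈ C \ {e} ∩ A := ⟨hx, hxA⟩
    rw [hne] at this
    exact this
  · by_contra hne
    rw [not_nonempty_iff_eq_empty] at hne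
    refine IsCircuit.not_subset_of_not_mem_closure hC heC hA (fun x hx => ?_)
    by_contra hxA
    have : x ∈ C \ {e} ∩ ((M.E \ {e}) \ A) := ⟨hx, ⟨hC.subset_ground hx.1, hx.2⟩, hxA⟩
    rw [hne] at this
    exact this

end S1

end PercRepro
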